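import Summits.NavierStokesRegularity.NavierStokesRegularity.Theorems.TypeICertificateLadderTargetStrainCubeDepletion
import HarnessLib

/-!
# Route `ExtremiserTransience` (crux `NearExtremalTransience`, stmt-NavierStokesRegularity-21883) — structure
# of near-extremisers, static part II: AN INTEGRABLE, EIGENVALUE-FREE UNIAXIALITY DEFECT CONTROLLED BY THE
# STRAIN-STATE DEFICIT OF THE DEPLETION CHAIN

`--supports stmt-NavierStokesRegularity-21883` (helper; sequel of `…NearExtremalTransienceMillerStability`).
The first link of the depletion chain is `|∫⟪ω, Dv ω⟫| = 4|∫det S| ≤ (2√6/9)∫|S|³` (Betchov + Miller;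
`abs_integral_stretching_le_integral_cube`). The companion file quantified Miller's equality case pointwise with
an eigenvector-dependent distance. For INTEGRATION along a field one wants a defect that is a plain function of
the entries of `S(x)`: the squared form of Miller's bound, `54 det(S)² ≤ |S|⁶` (tree `GurskyLeBrun.det_sq_le` =
non-negativity of the discriminant of the characteristic polynomial), suggests the **uniaxiality defect**

  `𝔡(S) := (|S|⁶/54 − det(S)²)/|S|³ = |S|³ · sin²(3φ)/54 ≥ 0`

(`φ` the Lund–Rogers strain-state angle; `𝔡(S) = 0` iff `S` is uniaxial or zero). This file proves:

* `DepletionLadder.StrainCube.four_abs_det_add_defect_le` — POINTWISE: for the symmetric part `s` of a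
  trace-free array, `4|det s| + 6√6·𝔡(s) ≤ (2√6/9)|s|³` (after multiplying by `|s|³` this is the square
  `(√6/9)(|s|³ − 3√6|det s|)² ≥ 0`; no spectral theorem).
* `DepletionLadder.StrainCube.abs_integral_stretching_add_defect_le_integral_cube` — INTEGRATED, on the
  admissible class of `abs_integral_stretching_le_integral_cube` (`C^∞`, divergence free, bounded with bounded
  gradient, `D¹v ∈ L²`):
  `|∫⟪ω, Dv ω⟫| + 6√6 ∫ 𝔡(S) ≤ (2√6/9) ∫ |S|³`.
  In the flow-wise language of the line (nsreg-p3 ROUND-24: `Λ♭ := |∫⟪ω,Dvω⟫| / ((2√6/9)∫|S|³)`): a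
  strain-state factor `Λ♭ ≥ 1 − ε` forces `∫𝔡(S) ≤ ε·∫|S|³/27`, i.e. the `|S|³`-weighted mean of `sin²(3φ)`
  is at most `2ε` — near-extremal stretching efficiency in the first link pins the strain to the uniaxial
  (`s* = ±1`) shapes in `|S|³`-measure. This is a theorem-backed OBSERVABLE for the instrument seats
  (`∫𝔡(S)` is a polynomial/radical expression in `∇v`, no eigen-decomposition).

WHAT THIS IS NOT: kinematics only (no Navier–Stokes); no depletion constant; nothing about the crux beyond the
structure of near-extremisers of its first pointwise link. References: E. Miller, Arch. Ration. Mech. Anal. 235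
(2020), Prop. 4.8; T. S. Lund, M. M. Rogers, Phys. Fluids 6 (1994) 1838. [folklore]
-/

noncomputable section

open Set Function Filter Topology MeasureTheory Finset
open scoped RealInnerProductSpace ENNReal NNReal ContDiff
open Literature.Analysis.FluidPDE

namespace Summit.NavierStokesRegularity.NavierStokesRegularity.Theorems.DepletionLadder.StrainCube

-- the problem directory repeats the summit name (`NavierStokesRegularity/NavierStokesRegularity`)
set_option linter.dupNamespace false

open Summit.NavierStokesRegularity.NavierStokesRegularity.Theorems.RungReynoldsOne.WeightedSlice

/-! ### 1. Pointwise: Miller's bound with the uniaxiality defect -/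

/-- The algebraic core: for `P ≥ 0` and any real `d`,
`4|d| + 6√6·(P²/54 − d²)/P ≤ (2√6/9)·P` — for `P > 0` this is `(√6/9)(P − 3√6|d|)² ≥ 0` after multiplying
by `P`, and for `P = 0` both sides vanish (`x/0 = 0`) once `d = 0`. [folklore] -/
theorem four_abs_add_defect_le_aux {P d : ℝ} (hP : 0 ≤ P) (hd : P = 0 → d = 0) :
    4 * |d| + 6 * Real.sqrt 6 * ((P ^ 2 / 54 - d ^ 2) / P) ≤ 2 / 9 * Real.sqrt 6 * P := by
  have h6 : Real.sqrt 6 ^ 2 = 6 := Real.sq_sqrt (by norm_num)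
  have h60 : 0 ≤ Real.sqrt 6 := Real.sqrt_nonneg _
  rcases eq_or_lt_of_le hP with hP0 | hP0
  · rw [← hP0, hd hP0.symm]
    simp
  · have key : 6 * Real.sqrt 6 * ((P ^ 2 / 54 - d ^ 2) / P) ≤ 2 / 9 * Real.sqrt 6 * P - 4 * |d| := by
      rw [← mul_div_assoc, div_le_iff₀ hP0]
      have hsq : 0 ≤ Real.sqrt 6 / 9 * (P - 3 * Real.sqrt 6 * |d|) ^ 2 := by positivity
      have habs : |d| ^ 2 = d ^ 2 := sq_abs d
      have hid : (2 / 9 * Real.sqrt 6 * P - 4 * |d|) * P - 6 * Real.sqrt 6 * (P ^ 2 / 54 - d ^ 2) =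
          Real.sqrt 6 / 9 * (P - 3 * Real.sqrt 6 * |d|) ^ 2 := by
        linear_combination (6 / 9 * |d| * P - Real.sqrt 6 * |d| ^ 2) * h6 - 6 * Real.sqrt 6 * habs
      linarith [hid, hsq]
    linarith

/-- **Miller's determinant bound with the uniaxiality defect (pointwise, eigenvalue-free).** For ANY real
`3 × 3` array `s`, with `|s|² = Σᵢⱼ sᵢⱼ²`, `|s|³ = |s|²√(|s|²)` and the uniaxiality defect
`𝔡(s) = ((|s|²)³/54 − (det s)²)/|s|³`:  `4|det s| + 6√6·𝔡(s) ≤ (2√6/9)|s|³` (an AM–GM square; no symmetry or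
trace condition is needed for this direction — they enter through `𝔡(s) ≥ 0`, `defect_nonneg`). For the symmetric
part of a trace-free array, equality iff `54 det² = |s|⁶`, i.e. iff `s` is uniaxial or zero (Miller's equality
case); `𝔡` vanishes exactly there. [folklore] -/
theorem four_abs_det_add_defect_le (s : Fin 3 → Fin 3 → ℝ) :
    4 * |(Matrix.of fun i j => s i j).det| +
        6 * Real.sqrt 6 * (((∑ i, ∑ j, s i j ^ 2) ^ 3 / 54 - (Matrix.of fun i j => s i j).det ^ 2) /
          ((∑ i, ∑ j, s i j ^ 2) * Real.sqrt (∑ i, ∑ j, s i j ^ 2))) ≤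
      2 / 9 * Real.sqrt 6 * ((∑ i, ∑ j, s i j ^ 2) * Real.sqrt (∑ i, ∑ j, s i j ^ 2)) := by
  set σ : ℝ := ∑ i, ∑ j, s i j ^ 2 with hσ
  have hσ0 : 0 ≤ σ := sum_nonneg fun _ _ => sum_nonneg fun _ _ => sq_nonneg _
  set P : ℝ := σ * Real.sqrt σ with hPdef
  have hP : 0 ≤ P := by positivity
  have hP2 : P ^ 2 = σ ^ 3 := by
    rw [hPdef, mul_pow, Real.sq_sqrt hσ0]; ring
  rw [← hP2]
  refine four_abs_add_defect_le_aux hP fun hP0 => ?_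
  -- `P = 0` ⇒ `σ = 0` ⇒ `s = 0` ⇒ `det s = 0`
  have hσz : σ = 0 := by
    rcases mul_eq_zero.1 hP0 with h | h
    · exact h
    · rwa [Real.sqrt_eq_zero hσ0] at h
  have hsz : ∀ i j, s i j = 0 := by
    intro i j
    have hle : s i j ^ 2 ≤ σ := by
      rw [hσ]
      exact (single_le_sum (f := fun j => s i j ^ 2) (fun _ _ => sq_nonneg _) (mem_univ j)).trans
        (single_le_sum (f := fun i => ∑ j, s i j ^ 2) (fun _ _ => sum_nonneg fun _ _ => sq_nonneg _)
          (mem_univ i))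
    rw [hσz] at hle
    exact pow_eq_zero_iff (n := 2) (by norm_num) |>.1 (le_antisymm hle (sq_nonneg _))
  have hM : (Matrix.of fun i j => s i j) = 0 := by
    ext i j; simp [hsz]
  rw [hM]
  exact Matrix.det_zero

/-- The uniaxiality defect is nonnegative: `54 det(s)² ≤ |s|⁶` (tree `GurskyLeBrun.det_sq_le`, the discriminant
of the characteristic polynomial of a symmetric trace-free `3 × 3` matrix). [folklore] -/
theorem defect_nonneg (g s : Fin 3 → Fin 3 → ℝ) (hs : ∀ i j, s i j = (g i j + g j i) / 2)
    (htr : g 0 0 + g 1 1 + g 2 2 = 0) :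
    0 ≤ ((∑ i, ∑ j, s i j ^ 2) ^ 3 / 54 - (Matrix.of fun i j => s i j).det ^ 2) /
      ((∑ i, ∑ j, s i j ^ 2) * Real.sqrt (∑ i, ∑ j, s i j ^ 2)) := by
  set S : Matrix (Fin 3) (Fin 3) ℝ := Matrix.of fun i j => s i j with hS
  have hsym : S.IsSymm := isSymm_of_sym g s hs
  have htrS : S.trace = 0 := trace_of_sym g s hs htr
  have h := Literature.Geometry.Riemannian.GurskyLeBrun.det_sq_le S hsym htrS
  have hF : ∑ i, ∑ j, S i j ^ 2 = ∑ i, ∑ j, s i j ^ 2 := by simp [hS]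
  rw [hF] at h
  have hσ0 : 0 ≤ ∑ i, ∑ j, s i j ^ 2 := sum_nonneg fun _ _ => sum_nonneg fun _ _ => sq_nonneg _
  refine div_nonneg (by linarith) (by positivity)

/-! ### 2. Integration over `ℝ³` -/

variable {v : EuclideanSpace ℝ (Fin 3) → EuclideanSpace ℝ (Fin 3)}
  {s : Fin 3 → Fin 3 → EuclideanSpace ℝ (Fin 3) → ℝ}

/-- **Pointwise, along a field**: `|⟪ω, Dv ω⟫ − 4 det Dv| + 6√6·𝔡(S(x)) ≤ (2√6/9)|S(x)|³` (Betchov's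
`⟪ω, Dv ω⟫ = 4 det Dv − 4 det S` plus `four_abs_det_add_defect_le`). [folklore] -/
theorem abs_stretching_sub_four_det_add_defect_le (hv : ContDiff ℝ ∞ v) (hdiv : VectorCalculus.IsDivFree v)
    (hs : ∀ i j y, s i j y = (pderiv j (fun z => v z i) y + pderiv i (fun z => v z j) y) / 2)
    (x : EuclideanSpace ℝ (Fin 3)) :
    |⟪curl v x, fderiv ℝ v x (curl v x)⟫ -
        4 * LinearMap.det (fderiv ℝ v x : EuclideanSpace ℝ (Fin 3) →ₗ[ℝ] EuclideanSpace ℝ (Fin 3))| +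
      6 * Real.sqrt 6 * (((∑ i, ∑ j, s i j x ^ 2) ^ 3 / 54 - (Matrix.of fun i j => s i j x).det ^ 2) /
        ((∑ i, ∑ j, s i j x ^ 2) * Real.sqrt (∑ i, ∑ j, s i j x ^ 2))) ≤
      (2 / 9) * Real.sqrt 6 * ((∑ i, ∑ j, s i j x ^ 2) * Real.sqrt (∑ i, ∑ j, s i j x ^ 2)) := by
  obtain ⟨h0, h1, h2⟩ := curl_apply_eq hv x
  have htr := grad_trace_eq_zero hv hdiv x
  rw [stretching_eq_sum hv, ← det_grad_eq hv]
  rw [vortStretch_eq_four_det_sub (fun i j => pderiv j (fun y => v y i) x) (fun i j => s i j x)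
    (fun k => curl v x k) (fun i j => hs i j x) h0 h1 h2 htr]
  have h := four_abs_det_add_defect_le (fun i j => s i j x)
  have e : 4 * (Matrix.of fun i j => pderiv j (fun y => v y i) x).det -
      4 * (Matrix.of fun i j => s i j x).det - 4 * (Matrix.of fun i j => pderiv j (fun y => v y i) x).det =
      -(4 * (Matrix.of fun i j => s i j x).det) := by ring
  rw [e, abs_neg, abs_mul, show |(4 : ℝ)| = 4 by norm_num]
  exact h

/-- **THE STRAIN-STATE DEFICIT CONTROLS THE UNIAXIALITY DEFECT (integrated).** For a `C^∞` divergence-free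
`v : ℝ³ → ℝ³` with `|v| ≤ M`, `‖Dv‖ ≤ B` and `D¹v ∈ L²` (the class of `abs_integral_stretching_le_integral_cube`),
`ω = curl v`, `S` the strain with entries `sᵢⱼ`, `|S|³ = |S|²√(|S|²)` and uniaxiality defect
`𝔡(S) = (|S|⁶/54 − det(S)²)/|S|³ ≥ 0`:

  `|∫⟪ω, Dv ω⟫| + 6√6 ∫ 𝔡(S) ≤ (2√6/9) ∫ |S|³`.

Hence if the first link of the depletion chain is saturated up to `ε`, `|∫⟪ω,Dvω⟫| ≥ (1−ε)(2√6/9)∫|S|³`, then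
`∫𝔡(S) ≤ (ε/27)∫|S|³`: the strain is uniaxial in `|S|³`-measure. Proof: `∫det Dv = 0`
(`integral_det_fderiv_eq_zero`), the pointwise bound `abs_stretching_sub_four_det_add_defect_le`, and
`0 ≤ 𝔡 ≤ (√6/162)·… ≤ (2√6/9)|S|³/(6√6)` for integrability. [folklore] -/
theorem abs_integral_stretching_add_defect_le_integral_cube (hv : ContDiff ℝ ∞ v)
    (hdiv : VectorCalculus.IsDivFree v)
    {M B : ℝ} (hM : ∀ x, ‖v x‖ ≤ M) (hB : ∀ x, ‖fderiv ℝ v x‖ ≤ B)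
    (h1 : ∫⁻ x, ‖iteratedFDeriv ℝ 1 v x‖ₑ ^ 2 < ⊤)
    (hs : ∀ i j y, s i j y = (pderiv j (fun z => v z i) y + pderiv i (fun z => v z j) y) / 2) :
    |∫ x, ⟪curl v x, fderiv ℝ v x (curl v x)⟫| +
        6 * Real.sqrt 6 * ∫ x, ((∑ i, ∑ j, s i j x ^ 2) ^ 3 / 54 - (Matrix.of fun i j => s i j x).det ^ 2) /
          ((∑ i, ∑ j, s i j x ^ 2) * Real.sqrt (∑ i, ∑ j, s i j x ^ 2)) ≤
      (2 / 9) * Real.sqrt 6 * ∫ x, (∑ i, ∑ j, s i j x ^ 2) * Real.sqrt (∑ i, ∑ j, s i j x ^ 2) := by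
  have hv1 : ContDiff ℝ 1 v := hv.of_le (by norm_cast)
  have hB0 : 0 ≤ B := (norm_nonneg _).trans (hB 0)
  have hsC := contDiff_sym hv hs
  have T1eq : ∀ x, ‖fderiv ℝ v x‖ = ‖iteratedFDeriv ℝ 1 v x‖ := fun x => norm_fderiv_eq_norm_iteratedFDeriv_one x
  set J : EuclideanSpace ℝ (Fin 3) → ℝ := fun x => ⟪curl v x, fderiv ℝ v x (curl v x)⟫ with hJ
  set dt : EuclideanSpace ℝ (Fin 3) → ℝ := fun x =>
    LinearMap.det (fderiv ℝ v x : EuclideanSpace ℝ (Fin 3) →ₗ[ℝ] EuclideanSpace ℝ (Fin 3)) with hdt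
  set c3 : EuclideanSpace ℝ (Fin 3) → ℝ := fun x =>
    (∑ i, ∑ j, s i j x ^ 2) * Real.sqrt (∑ i, ∑ j, s i j x ^ 2) with hc3
  set D : EuclideanSpace ℝ (Fin 3) → ℝ := fun x =>
    ((∑ i, ∑ j, s i j x ^ 2) ^ 3 / 54 - (Matrix.of fun i j => s i j x).det ^ 2) /
      ((∑ i, ∑ j, s i j x ^ 2) * Real.sqrt (∑ i, ∑ j, s i j x ^ 2)) with hD
  have c60 : 0 < 6 * Real.sqrt 6 := by positivity
  -- `∫ det Dv = 0`
  have hdet0 : ∫ x, dt x = 0 := integral_det_fderiv_eq_zero hv hM hB h1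
  -- pointwise facts
  have hpt : ∀ x, |J x - 4 * dt x| + 6 * Real.sqrt 6 * D x ≤ (2 / 9) * Real.sqrt 6 * c3 x := fun x =>
    abs_stretching_sub_four_det_add_defect_le hv hdiv hs x
  have hD0 : ∀ x, 0 ≤ D x := fun x =>
    defect_nonneg (fun i j => pderiv j (fun y => v y i) x) (fun i j => s i j x) (fun i j => hs i j x)
      (grad_trace_eq_zero hv hdiv x)
  -- integrability of `J`, `|S|³`, `det`, `D`
  have cJ : Continuous J := (continuous_curl hv1).inner
    ((hv1.continuous_fderiv one_ne_zero).clm_apply (continuous_curl hv1))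
  have iJ : Integrable J := by
    refine integrable_of_le_iteratedFDeriv_mul hv h1 h1 cJ (‖curlCLM‖ ^ 2 * B) fun x => ?_
    have hc := norm_curl_le v x
    rw [T1eq] at hc
    have hB' : ‖fderiv ℝ v x‖ ≤ B := hB x
    calc |J x| ≤ ‖curl v x‖ * ‖fderiv ℝ v x (curl v x)‖ := abs_real_inner_le_norm _ _
      _ ≤ ‖curl v x‖ * (‖fderiv ℝ v x‖ * ‖curl v x‖) :=
          mul_le_mul_of_nonneg_left ((fderiv ℝ v x).le_opNorm _) (norm_nonneg _)
      _ ≤ (‖curlCLM‖ * ‖iteratedFDeriv ℝ 1 v x‖) * (B * (‖curlCLM‖ * ‖iteratedFDeriv ℝ 1 v x‖)) :=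
          mul_le_mul hc (mul_le_mul hB' hc (norm_nonneg _) hB0) (by positivity) (by positivity)
      _ = ‖curlCLM‖ ^ 2 * B * ‖iteratedFDeriv ℝ 1 v x‖ * ‖iteratedFDeriv ℝ 1 v x‖ := by ring
  have cq : Continuous fun x => ∑ i, ∑ j, s i j x ^ 2 := continuous_finsetSum _ fun i _ =>
    continuous_finsetSum _ fun j _ => ((hsC i j).continuous).pow 2
  have cc3 : Continuous c3 := cq.mul (Real.continuous_sqrt.comp cq)
  have ic3 : Integrable c3 := by
    refine integrable_of_le_iteratedFDeriv_mul hv h1 h1 cc3 (27 * B) fun x => ?_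
    have hq0 : 0 ≤ ∑ i, ∑ j, s i j x ^ 2 := sumSq_nonneg (s := s) x
    rw [hc3]; simp only
    rw [abs_mul, abs_of_nonneg hq0, abs_of_nonneg (Real.sqrt_nonneg _)]
    have hB' : ‖iteratedFDeriv ℝ 1 v x‖ ≤ B := by rw [← T1eq]; exact hB x
    have T0 : 0 ≤ ‖iteratedFDeriv ℝ 1 v x‖ := norm_nonneg _
    calc (∑ i, ∑ j, s i j x ^ 2) * Real.sqrt (∑ i, ∑ j, s i j x ^ 2)
        ≤ (9 * ‖iteratedFDeriv ℝ 1 v x‖ ^ 2) * (3 * ‖iteratedFDeriv ℝ 1 v x‖) :=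
          mul_le_mul (sumSq_sym_le hv hs x) (sqrt_sumSq_sym_le hv hs x) (Real.sqrt_nonneg _) (by positivity)
      _ = (27 * ‖iteratedFDeriv ℝ 1 v x‖ * ‖iteratedFDeriv ℝ 1 v x‖) * ‖iteratedFDeriv ℝ 1 v x‖ := by ring
      _ ≤ (27 * ‖iteratedFDeriv ℝ 1 v x‖ * ‖iteratedFDeriv ℝ 1 v x‖) * B :=
          mul_le_mul_of_nonneg_left hB' (by positivity)
      _ = 27 * B * ‖iteratedFDeriv ℝ 1 v x‖ * ‖iteratedFDeriv ℝ 1 v x‖ := by ring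
  have cdt : Continuous dt := ContinuousLinearMap.continuous_det.comp (hv1.continuous_fderiv one_ne_zero)
  have idt : Integrable dt := by
    refine ((iJ.abs.add (ic3.const_mul ((2 / 9) * Real.sqrt 6))).const_mul (1 / 4)).mono'
      cdt.aestronglyMeasurable (Eventually.of_forall fun x => ?_)
    have h := hpt x
    have hDx := hD0 x
    rw [Real.norm_eq_abs]
    change |dt x| ≤ 1 / 4 * (|J x| + (2 / 9) * Real.sqrt 6 * c3 x)
    have h' : |J x - 4 * dt x| ≤ (2 / 9) * Real.sqrt 6 * c3 x := by
      have := mul_nonneg c60.le hDx; linarith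
    rw [abs_le] at h'
    have hJ1 := le_abs_self (J x)
    have hJ2 := neg_abs_le (J x)
    rw [abs_le]
    constructor <;> linarith [h'.1, h'.2]
  -- measurability of the defect: a continuous determinant, sums, square root and a division
  have cdetS : Continuous fun x => (Matrix.of fun i j => s i j x).det := by
    refine Continuous.matrix_det ?_
    exact continuous_pi fun i => continuous_pi fun j => (hsC i j).continuous
  have mD : Measurable D :=
    (((cq.pow 3).div_const 54).sub (cdetS.pow 2)).measurable.div (cq.mul (Real.continuous_sqrt.comp cq)).measurable
  have iD : Integrable D := by
    refine (ic3.const_mul ((2 / 9) * Real.sqrt 6 / (6 * Real.sqrt 6))).mono' mD.aestronglyMeasurable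
      (Eventually.of_forall fun x => ?_)
    rw [Real.norm_eq_abs, abs_of_nonneg (hD0 x)]
    have h := hpt x
    have ha : 0 ≤ |J x - 4 * dt x| := abs_nonneg _
    rw [show (2 / 9) * Real.sqrt 6 / (6 * Real.sqrt 6) * c3 x = ((2 / 9) * Real.sqrt 6 * c3 x) / (6 * Real.sqrt 6)
      by ring, le_div_iff₀ c60]
    linarith
  -- integrate the two one-sided pointwise bounds
  have iDc : Integrable (fun x => 6 * Real.sqrt 6 * D x) := iD.const_mul _
  have idt4 : Integrable (fun x => 4 * dt x) := idt.const_mul 4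
  have ic3c : Integrable (fun x => (2 / 9) * Real.sqrt 6 * c3 x) := ic3.const_mul _
  have hup : (∫ x, J x) + 6 * Real.sqrt 6 * ∫ x, D x ≤ (2 / 9) * Real.sqrt 6 * ∫ x, c3 x := by
    have iA : Integrable (fun x => J x + 6 * Real.sqrt 6 * D x) := iJ.add iDc
    have iL : Integrable (fun x => (J x + 6 * Real.sqrt 6 * D x) - 4 * dt x) := iA.sub idt4
    have h := integral_mono iL ic3c (fun x => by
      have h := hpt x
      change (J x + 6 * Real.sqrt 6 * D x) - 4 * dt x ≤ (2 / 9) * Real.sqrt 6 * c3 x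
      have := le_abs_self (J x - 4 * dt x)
      linarith)
    rw [integral_sub iA idt4, integral_add iJ iDc,
      integral_const_mul, integral_const_mul, integral_const_mul, hdet0] at h
    linarith
  have hlo : -(∫ x, J x) + 6 * Real.sqrt 6 * ∫ x, D x ≤ (2 / 9) * Real.sqrt 6 * ∫ x, c3 x := by
    have iJn : Integrable (fun x => -J x) := iJ.neg
    have iA : Integrable (fun x => -J x + 6 * Real.sqrt 6 * D x) := iJn.add iDc
    have iL : Integrable (fun x => (-J x + 6 * Real.sqrt 6 * D x) + 4 * dt x) := iA.add idt4
    have h := integral_mono iL ic3c (fun x => by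
      have h := hpt x
      change (-J x + 6 * Real.sqrt 6 * D x) + 4 * dt x ≤ (2 / 9) * Real.sqrt 6 * c3 x
      have := neg_abs_le (J x - 4 * dt x)
      linarith)
    rw [integral_add iA idt4, integral_add iJn iDc,
      integral_neg, integral_const_mul, integral_const_mul, integral_const_mul, hdet0] at h
    linarith
  rcases le_total 0 (∫ x, J x) with hJ0 | hJ0
  · rw [abs_of_nonneg hJ0]; exact hup
  · rw [abs_of_nonpos hJ0]; exact hlo

end Summit.NavierStokesRegularity.NavierStokesRegularity.Theorems.DepletionLadder.StrainCube

end
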